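import Summits.QuantumFields.YangMills.Theorems.BalabanUVNodesN15KingModelSlicesTorusGrad
import Literature.MathematicalPhysics.QuantumFieldTheory.King1986.CovarianceSplittingUnits

/-!
# BalabanUVNodes ∕ N15 — THE KING-MODEL RUNG, CURVED EDITION (PART K): THE SLICE IS THE SLICE — part F's `A = 0` single-scale
# piece `ksSlice = Σ_{z,w} ℋ_j(x, z)·C^{(j)}(z, w)·ℋ_j(y, w)` IS King's `G^ε_{(j)} = G^ε_{j+1} − G^ε_j` of (2.17), EXACTLY, for the
# tree's constrained propagators at consecutive block sizes (King's (4.42) «we have the expansion» PROVED for the objects of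
# p479910 ∕ p482267); the gradient piece of part H is its forward η-derivative
# (Track A, DAG node N15 = NE2; FAN-OUT v1.1 §N15 s3 «KING-MODEL RUNG … + the one-line statement of what the curved case adds»)

HONEST FRAMING.  Count-neutral kernel bookkeeping (cell `pub-ymgap`, seat `pub-ymgap-dag-n15-e` g5; `--supports stmt-QuantumFields-19908
--as helper` = K3′ `SpineGivenEndpointR12`, lineage K3 19676).  TEMPLATE LITERATURE, `A = 0`: C. King's scalar U(1)-Higgs MODEL on finite tori
([King1986] §2.2 p. 653 (2.13)–(2.17), p. 654 (2.20), §4 p. 675 (4.42)), NOT Bałaban's covariant objects; NE2⁺ is NOT PRINTED for those and not proved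
here; NOT a node discharge; nothing continuum ∕ ℝ⁴ ∕ OS ∕ mass-gap ∕ Clay.  0 `sorry`, 0 `def`, standard axioms.

THE POINT.  Part F (`…N15KingModelSlicesTorus`, p479910) DEFINED the `A = 0` member of NE2's slice family as the King-TYPE piece
`ksSlice(x, y) = Σ_w (Σ_z ℋ_j(x, z)·C^{(j)}(z, w))·ℋ_j(y, w)` and proved its two-spacing rate; its HONEST SCOPE (iii) recorded that this was «a MODEL
family, not a transcription of (2.17)» because King's slice `G^ε_{(j)}` is DEFINED on p. 653 as the `j`-th term of the decomposition (2.17),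
`G^ε_k = C^{(0),ε} + Σ_{j=1}^{k−1} a_j²(L^jε)^{−4}G^ε_jQ_j^*·C^{(j),L^jε}·Q_jG^ε_j ≡ Σ_{j=0}^{k−1} G^ε_{(j)}` — an identity King STATES («with the obvious definition of
G^ε_{(j)}»; (4.42) «we have the expansion») and does not prove.  The Literature modules `King1986/CovarianceSplitting` (p491354) and
`King1986/CovarianceSplittingUnits` (this seat, g5) PROVE the one-step form of (2.17) as an exact matrix identity on the nested torus, for the
tree's `fineOp` ∕ `effLaplacian` ∕ `minimiser` ∕ `blockProj`:  `G^ε_{j+1} − G^ε_j = ℋ_j·C^{(j)}·ℋ_jᵀ`  (`constrainedProp₂_eq`, kernel form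
`constrainedProp₂_sub_apply_minimiser`), identify the coefficient (`nextLevelCoeff_aK`: `a_{j+1}∕L²`) and the level-`(j+1)` propagator with
(2.13) at level `j + 1` in its own units on the flat torus up to King's (2.20) factor `L^{d−2}` (`constrainedProp_succ_flatten`,
`king217_oneStep`).  THIS FILE reads those theorems on part F's objects — every factor of `ksSlice` IS the corresponding King object BY NAME:
* §1 `ksC_eq_oneStepCov` ∕ `ksC'_eq_oneStepCov` (part F's middle factor = `(Δ^{(j)} + aL⁻²Q^*Q)⁻¹` = `King1986.Torus.oneStepCov`, `rfl` ∕ `N`-spelling),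
  `ksH_eq_minimiserMat` ∕ `ksH'_eq_minimiserMat` (the legs are the minimiser matrix);
* §2 **`ksSlice_eq_sub`** ∕ **`ksSlice'_eq_sub`**: `ksSlice(x, y) = G^ε_{j+1}(x, y) − G^ε_j(x, y)` (level-`j` units, nested torus: `constrainedProp₂ −
  constrainedProp`), in BOTH runs (coarse `L^j`, fine `L^nL^j` points per scale-`j` site) — part F's member IS King's slice at its mass;
* §3 **`ksSlice_eq_king`**: the same with the level-`(j+1)` propagator BY NAME in its own units, `ksSlice(x, y) = L^{2−(d+1)}·G^ε_{j+1}(flatten x,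
  flatten y) − G^ε_j(x, y)`, `G^ε_{j+1} = (L^jL)^{d+1}·(fineOp (L^j·L) U a_{j+1} ((L^jL)²) (L²m²))⁻¹` — (2.17) ∘ (2.20) for the tree's objects;
* §4 **`ksDSlice_eq_fwdDiff`**: part H's gradient piece `Σ(Σ ∂^η_μℋ_j·C^{(j)})·ℋ_j` is `L^j·(ksSlice(x + e_μ, y) − ksSlice(x, y))`, hence
  (`ksDSlice_eq_sub`) the forward η-derivative of `G^ε_{j+1} − G^ε_j` in the observation point — King's `∂^η G^ε_{(j)}` of (3.73) line 2, by name.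
CONSEQUENCE FOR THE LINEAGE.  Parts F∕G∕H∕I (p479910, p480293, p482267, p483275) are statements about King's ACTUAL slices `G^ε_{(j)}` (each member at
its own mass `m²` in scale-`j` units): HONEST SCOPE (iii) of part F shrinks to «the (2.20) mass bookkeeping `m² ↦ m²(L^jη)²` ACROSS `j` is not
uniformised in the tree's constants» — the King-TYPE caveat on the OBJECT is gone.
HONEST SCOPE.  (i) `A = 0`, periodic b.c., odd `L ≥ 3` where part F needs it (here `L ≥ 2`), `m² > 0`, flat blocks; (ii) lattice units as in part F;
(iii) as just said; (iv) `j ≥ 1`; (v) nothing here is Bałaban's `G_k(U)`; not a discharge.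
Locators: [King1986] C. King, CMP **102** (1986) 649–677: (2.13)–(2.17) p. 653, (2.20) p. 654, Prop. 3.9 (3.73) p. 665, (4.42) p. 675.
-/

noncomputable section

namespace Summit.QuantumFields.YangMills.BalabanUVNodes.N15KingModelRung.Curved

open Real Finset Matrix
open Literature.MathematicalPhysics.QuantumFieldTheory.Balaban1983to89.B5Prop11Plancherel (Tor fine unitVec)
open Literature.MathematicalPhysics.QuantumFieldTheory.King1986 (aK aK_pos)
open Literature.MathematicalPhysics.QuantumFieldTheory.King1986.Torus (minimiser fineOp constrainedProp constrainedProp₂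
  oneStepCov minimiserMat minimiserMat_apply flatten constrainedProp₂_sub_apply_minimiser king217_oneStep)
open Summit.QuantumFields.YangMills.BalabanUVNodes.N15.KingModel (kingCov kingCov_congrN)

variable {d : ℕ} (L : ℕ) [NeZero L]

/-! ## §1 The factors of part F's piece are King's objects by name -/

/-- Part F's middle factor IS King's one-step covariance `(Δ^{(j)} + aL⁻²Q^*Q)⁻¹` of (2.16): `ksC = oneStepCov` (definitional).
[cite: King1986, (2.16) p.653, (4.32) p.674] -/
theorem ksC_eq_oneStepCov (a m2 : ℝ) (i : KSliceIdx d) :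
    ksC L a m2 i = oneStepCov (L ^ i.j) L (ksM L i) (aK a L i.j) a (((L ^ i.j : ℕ) : ℝ) ^ 2) m2 := rfl

/-- The same for the fine run (King's `C^{(j+n),L^jη}`), with the number of fine points spelled `L^nL^j`. [cite: King1986, (2.16) p.653, (4.42) p.675] -/
theorem ksC'_eq_oneStepCov (a m2 : ℝ) (i : KSliceIdx d) :
    ksC' L a m2 i
      = oneStepCov (L ^ i.n * L ^ i.j) L (ksM L i) (aK a L (i.j + i.n)) a (((L ^ i.n * L ^ i.j : ℕ) : ℝ) ^ 2) m2 := by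
  have h : L ^ (i.j + i.n) = L ^ i.n * L ^ i.j := by rw [pow_add, mul_comm]
  unfold ksC'
  rw [kingCov_congrN (ksM L i) h]
  rfl

/-- Part F's coarse leg IS the minimiser matrix: `ℋ_j(x, z) = minimiserMat … x z`. [cite: King1986, (2.15) p.653, (4.42) p.675] -/
theorem ksH_eq_minimiserMat (a m2 : ℝ) (i : KSliceIdx d) (x : Tor (fine (L ^ i.j) (ksU L i))) (z : Tor (ksU L i)) :
    ksH L a m2 i x z = minimiserMat (L ^ i.j) (ksU L i) (aK a L i.j) (((L ^ i.j : ℕ) : ℝ) ^ 2) m2 x z := by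
  rw [minimiserMat_apply]
  rfl

/-- … and the fine leg: `ℋ_{j+n}(x′, z) = minimiserMat … x′ z`. [cite: King1986, (2.15) p.653, (4.42) p.675] -/
theorem ksH'_eq_minimiserMat (a m2 : ℝ) (i : KSliceIdx d) (x' : Tor (fine (L ^ i.n * L ^ i.j) (ksU L i)))
    (z : Tor (ksU L i)) :
    ksH' L a m2 i x' z
      = minimiserMat (L ^ i.n * L ^ i.j) (ksU L i) (aK a L (i.j + i.n)) (((L ^ i.n * L ^ i.j : ℕ) : ℝ) ^ 2) m2 x' z := by
  rw [minimiserMat_apply]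
  rfl

/-! ## §2 THE SLICE IS THE SLICE: `ksSlice = G^ε_{j+1} − G^ε_j` -/

/-- **Part F's `A = 0` member IS King's slice `G^ε_{(j)} = G^ε_{j+1} − G^ε_j` (coarse run)**: for every index, every `a > 0`, `m² > 0`, `L ≥ 2`
and all fine points `x, y`,  `ksSlice(x, y) = G^ε_{j+1}(x, y) − G^ε_j(x, y)`, the two propagators being King's block-constrained
propagators at block sizes `L^{j+1}` and `L^j` (level-`j` units on the nested torus: `King1986.Torus.constrainedProp₂` ∕ `constrainedProp`
= `(L^j)^{d+1}·(fineOp …)⁻¹`) — King's (4.42) «we have the expansion», a THEOREM for the tree's objects. [cite: King1986, (2.17) p.653, (4.42) p.675] -/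
theorem ksSlice_eq_sub (hL : 2 ≤ L) {a m2 : ℝ} (ha : 0 < a) (hm : 0 < m2) (i : KSliceIdx d)
    (x y : Tor (fine (L ^ i.j) (ksU L i))) :
    ksSlice L a m2 i x y
      = constrainedProp₂ (L ^ i.j) L (ksM L i) (aK a L i.j) a (((L ^ i.j : ℕ) : ℝ) ^ 2) m2 x y
        - constrainedProp (L ^ i.j) (ksU L i) (aK a L i.j) (((L ^ i.j : ℕ) : ℝ) ^ 2) m2 x y := by
  have hLr : (1 : ℝ) < L := by exact_mod_cast (show 1 < L by omega)
  rw [constrainedProp₂_sub_apply_minimiser (L ^ i.j) L (ksM L i) ha (aK_pos ha hLr i.one_le_j) (sq_nonneg _) hm]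
  rfl

/-- **The same in the fine run**: `ksSlice′(x′, y′) = G^{ε′}_{j+n+1}(x′, y′) − G^{ε′}_{j+n}(x′, y′)` (`L^nL^j` fine points per scale-`j` site,
coefficient `a_{j+n}`). [cite: King1986, (2.17) p.653, (4.42) p.675] -/
theorem ksSlice'_eq_sub (hL : 2 ≤ L) {a m2 : ℝ} (ha : 0 < a) (hm : 0 < m2) (i : KSliceIdx d)
    (x' y' : Tor (fine (L ^ i.n * L ^ i.j) (ksU L i))) :
    ksSlice' L a m2 i x' y'
      = constrainedProp₂ (L ^ i.n * L ^ i.j) L (ksM L i) (aK a L (i.j + i.n)) a (((L ^ i.n * L ^ i.j : ℕ) : ℝ) ^ 2) m2 x' y'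
        - constrainedProp (L ^ i.n * L ^ i.j) (ksU L i) (aK a L (i.j + i.n)) (((L ^ i.n * L ^ i.j : ℕ) : ℝ) ^ 2) m2 x' y' := by
  have hLr : (1 : ℝ) < L := by exact_mod_cast (show 1 < L by omega)
  have hjn : 1 ≤ i.j + i.n := by have := i.one_le_j; omega
  rw [constrainedProp₂_sub_apply_minimiser (L ^ i.n * L ^ i.j) L (ksM L i) ha (aK_pos ha hLr hjn) (sq_nonneg _) hm,
    ksSlice', triple, ksC'_eq_oneStepCov]
  rfl

/-! ## §3 … with the level-`(j+1)` propagator BY NAME in its own units: (2.17) ∘ (2.20) -/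

/-- **`ksSlice(x, y) = L^{2−(d+1)}·G^ε_{j+1}(flatten x, flatten y) − G^ε_j(x, y)`**, where NOW `G^ε_{j+1} = King1986.Torus.constrainedProp (L^j·L) U
a_{j+1} ((L^jL)²) (L²m²)` is (2.13) at level `j + 1` in ITS OWN units on the flat torus `Tor (fine (L^j·L) U)` (`(L^jL)^{d+1}·A₀⁻¹`, mass `L²m²`),
`flatten` the re-indexing of the nested torus, and `L^{2−(d+1)} = (ε′∕ε)^{2−d}` King's rescaling factor (2.20); `G^ε_j = constrainedProp (L^j) U a_j
((L^j)²) m²`.  (2.17) one step, everything by name, for part F's member. [cite: King1986, (2.13)–(2.17) p.653, (2.20) p.654, (4.42) p.675] -/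
theorem ksSlice_eq_king (hL : 2 ≤ L) {a m2 : ℝ} (ha : 0 < a) (hm : 0 < m2) (i : KSliceIdx d)
    (x y : Tor (fine (L ^ i.j) (ksU L i))) :
    ksSlice L a m2 i x y
      = (L : ℝ) ^ 2 / (L : ℝ) ^ (d + 1)
            * constrainedProp (L ^ i.j * L) (ksM L i) (aK a L (i.j + 1)) (((L ^ i.j * L : ℕ) : ℝ) ^ 2) (((L : ℝ) ^ 2) * m2)
                (flatten (L ^ i.j) L (ksM L i) x) (flatten (L ^ i.j) L (ksM L i) y)
        - constrainedProp (L ^ i.j) (ksU L i) (aK a L i.j) (((L ^ i.j : ℕ) : ℝ) ^ 2) m2 x y := by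
  rw [king217_oneStep (L ^ i.j) L (ksM L i) ha hL i.one_le_j hm]
  rfl

/-! ## §4 Part H's gradient piece is the forward η-derivative of the slice -/

/-- Linearity of the triple contraction in its first leg (differences). [folklore] -/
theorem triple_sub_left {U : Type*} [Fintype U] (f f' : U → ℝ) (C : Matrix U U ℝ) (g : U → ℝ) :
    triple (fun z => f z - f' z) C g = triple f C g - triple f' C g := by
  simp only [triple, sub_mul, Finset.sum_sub_distrib]

/-- Linearity of the triple contraction in its first leg (scalars). [folklore] -/
theorem triple_smul_left {U : Type*} [Fintype U] (s : ℝ) (f : U → ℝ) (C : Matrix U U ℝ) (g : U → ℝ) :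
    triple (fun z => s * f z) C g = s * triple f C g := by
  rw [triple, triple, Finset.mul_sum]
  refine Finset.sum_congr rfl fun w _ => ?_
  have h : (∑ z, s * f z * C z w) = s * ∑ z, f z * C z w := by
    rw [Finset.mul_sum]
    exact Finset.sum_congr rfl fun z _ => by ring
  rw [h]
  ring

/-- **Part H's gradient piece is a forward difference of part F's piece**: `ksDSlice_μ(x, y) = L^j·(ksSlice(x + e_μ, y) − ksSlice(x, y))`
(`∂^η_μ` with `η⁻¹ = L^j` acts on the first leg `ℋ_j`, and the contraction is linear in it). [cite: King1986, (4.42) p.675, Prop. 3.9 (3.73) p.665 (second line, object)] -/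
theorem ksDSlice_eq_fwdDiff (a m2 : ℝ) (i : KSliceIdx d) (μ : Fin (d + 1)) (x y : Tor (fine (L ^ i.j) (ksU L i))) :
    ksDSlice L a m2 i μ x y
      = ((L ^ i.j : ℕ) : ℝ) * (ksSlice L a m2 i (x + unitVec (fine (L ^ i.j) (ksU L i)) μ) y - ksSlice L a m2 i x y) := by
  rw [ksDSlice, ksSlice, ksSlice, ← triple_sub_left, ← triple_smul_left]
  rfl

/-- **… hence the forward η-derivative of King's slice kernel**: `ksDSlice_μ(x, y) = L^j·[(G^ε_{j+1} − G^ε_j)(x + e_μ, y) − (G^ε_{j+1} − G^ε_j)(x, y)]`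
= `∂^η_μ G^ε_{(j)}(x, y)` of (3.73) line 2, by name. [cite: King1986, (2.17) p.653, Prop. 3.9 (3.73) p.665, (4.42) p.675] -/
theorem ksDSlice_eq_sub (hL : 2 ≤ L) {a m2 : ℝ} (ha : 0 < a) (hm : 0 < m2) (i : KSliceIdx d) (μ : Fin (d + 1))
    (x y : Tor (fine (L ^ i.j) (ksU L i))) :
    ksDSlice L a m2 i μ x y
      = ((L ^ i.j : ℕ) : ℝ) *
          ((constrainedProp₂ (L ^ i.j) L (ksM L i) (aK a L i.j) a (((L ^ i.j : ℕ) : ℝ) ^ 2) m2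
                (x + unitVec (fine (L ^ i.j) (ksU L i)) μ) y
              - constrainedProp (L ^ i.j) (ksU L i) (aK a L i.j) (((L ^ i.j : ℕ) : ℝ) ^ 2) m2
                (x + unitVec (fine (L ^ i.j) (ksU L i)) μ) y)
            - (constrainedProp₂ (L ^ i.j) L (ksM L i) (aK a L i.j) a (((L ^ i.j : ℕ) : ℝ) ^ 2) m2 x y
              - constrainedProp (L ^ i.j) (ksU L i) (aK a L i.j) (((L ^ i.j : ℕ) : ℝ) ^ 2) m2 x y)) := by
  rw [ksDSlice_eq_fwdDiff, ksSlice_eq_sub L hL ha hm, ksSlice_eq_sub L hL ha hm]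


/-! ## §5 (v1.1) The two-spacing rate of King's ACTUAL slice, by name

UNITS NOTE (referee dag-ref-B READ-464, advisory NIT on parts F∕G): all kernels here and in parts F–I are in LATTICE units of the
scale-`j` lattice (HONEST SCOPE (ii) of part F).  A physical-units reader multiplies the slice kernel by King's `(L^jη)^{2−d}` of
(2.20) ∕ (4.42) — cf. `King1986.Torus.constrainedProp_succ_flatten`, where the one-level change of units appears as the factor
`L^{(d+1)−2}` — before consuming the `NE2PlusSite` readings of parts G ∕ I; the rate `(L^{−γ∕2})^j` and the uniform `(C, δ)` are
unit-free. -/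

open Literature.MathematicalPhysics.QuantumFieldTheory.King1986.Torus (blockOf tdistT)

/-- **THE TWO-SPACING RATE OF KING'S SLICE `G^ε_{(j)} = G^ε_{j+1} − G^ε_j` AT `A = 0`, BY NAME** (part F's `ksSlice_rate` rewritten through
§2): one `(C, δ)` (functions of `d, L, a, m², γ`) such that for every index and all fine points `x′, y′` over `x, y`,
`|(G^{ε′}_{j+n+1} − G^{ε′}_{j+n})(x′, y′) − (G^ε_{j+1} − G^ε_j)(x, y)| ≤ C·(L^{−γ∕2})^j·e^{−δ|B(x) − B(y)|_U}` — King's (3.73) line 1 for the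
internal slices of (2.17), at `A = 0`, for the tree's constrained propagators (lattice units, mass `m²` in scale-`j` units).
[cite: King1986, (2.17) p.653, Prop. 3.9 (3.73) p.665, (4.42)–(4.43) p.675] -/
theorem kingSlice_rate (hLodd : Odd L) (hL : 2 ≤ L) {a m2 : ℝ} (ha : 0 < a) (hm : 0 < m2) {γ : ℝ} (hγ0 : 0 ≤ γ)
    (hγ1 : γ ≤ 1) :
    ∃ C δ : ℝ, 0 < C ∧ 0 < δ ∧ ∀ (i : KSliceIdx d) (x' y' : Tor (fine (L ^ i.n * L ^ i.j) (ksU L i))),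
      |(constrainedProp₂ (L ^ i.n * L ^ i.j) L (ksM L i) (aK a L (i.j + i.n)) a (((L ^ i.n * L ^ i.j : ℕ) : ℝ) ^ 2) m2 x' y'
          - constrainedProp (L ^ i.n * L ^ i.j) (ksU L i) (aK a L (i.j + i.n)) (((L ^ i.n * L ^ i.j : ℕ) : ℝ) ^ 2) m2 x' y')
        - (constrainedProp₂ (L ^ i.j) L (ksM L i) (aK a L i.j) a (((L ^ i.j : ℕ) : ℝ) ^ 2) m2
              (underPtN L i.j i.n (ksU L i) x') (underPtN L i.j i.n (ksU L i) y')
            - constrainedProp (L ^ i.j) (ksU L i) (aK a L i.j) (((L ^ i.j : ℕ) : ℝ) ^ 2) m2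
              (underPtN L i.j i.n (ksU L i) x') (underPtN L i.j i.n (ksU L i) y'))|
        ≤ C * (((L : ℝ) ^ (-(γ / 2))) ^ i.j)
          * Real.exp (-(δ * tdistT (ksU L i) (blockOf (L ^ i.j) (ksU L i) (underPtN L i.j i.n (ksU L i) x'))
              (blockOf (L ^ i.j) (ksU L i) (underPtN L i.j i.n (ksU L i) y')))) := by
  obtain ⟨C, δ, hC, hδ, H⟩ := ksSlice_rate (d := d) L hLodd hL ha hm hγ0 hγ1
  refine ⟨C, δ, hC, hδ, fun i x' y' => ?_⟩
  rw [← ksSlice'_eq_sub L hL ha hm, ← ksSlice_eq_sub L hL ha hm]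
  exact H i x' y'

end Summit.QuantumFields.YangMills.BalabanUVNodes.N15KingModelRung.Curved
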